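import Literature.MathematicalPhysics.QuantumFieldTheory.Balaban1983to89.Beta.AveragedAFCarrierScalewise
import Literature.MathematicalPhysics.QuantumFieldTheory.Balaban1983to89.Beta.SquareTable

/-!
# Bałaban's lattice YM₄ RG programme — β-function sub-cell: JOINT NON-VACUITY OF THE STATEMENT-GRADE WALL
# (lead lineage strat-b12, gen 9; closes the «still untested: joint non-trivial inhabitation of the full binder list» note of
# XREADs C-lit3g14-1 (f) / C-lit3g14-1a and beta-ref A-R290 on the END statement)

HONEST FRAMING (cell rule, verbatim): «discharging `BetaPertH` makes Bałaban's UV stability UNCONDITIONAL — a real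
constructive-QFT result; it is NOT the continuum limit and NOT the Clay problem.»  This module DISCHARGES NOTHING of the wall and
asserts nothing about Bałaban's propagators, minimisers or β-functions.  It is [folklore] bookkeeping over kernel theorems of this
package; it cites no printed statement as a hypothesis; NOT summit progress.

## What is proved

The β sub-cell's wall at END-STATEMENT grade is ONE theorem,
`AveragedAFCarrierScalewise.endpointExistence_trivial_avg_remainderConst` (BETA/WALL.md v1.9 §3, beta-ref A-R306): twenty-eight
explicit binders — the split datum `Sβ`, table (W1)₀ `hdeg hval` (+ `hμν hN hL`), base points / convex weights `hwt0 hwt1`, window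
`hc hM hML`, sign data `hR hS hR' hS' hδ`, the per-base-point leg data (D3) `hF hG hFtail hGtail`, the one-loop representation (D1) `hD1`,
the remainder (D4) `hrem hr`, continuity and the printed-type upper bound (D5) `hcont hup hβ'`, `hγ₀`, and the structural `hgen` — imply
`EndpointExistence Cn`.  The XREADs of the END forms recorded that the JOINT inhabitation of this list had not been tested (an
inconsistent list would make the wall vacuous; beta-ref C-beta-167 / lit3 C-lit3g14-1 (f) tested only the (R16-1) sub-block).

Here the list is inhabited JOINTLY and NON-DEGENERATELY, by explicit data built from objects already in the tree:
* the table is an3's REALISED background-field table `(univ, bfCoeff N, bfP, bfQ)` (`SquareTable.hdeg_bf`, `SquareTable.hval_bf`: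
  degree 6, continuum bubble `= leadingIntegrand (kappaBal N)`), any `N ≠ 0`, any block size `Lc ≥ 2`, any `μ ≠ ν`;
* one base point, weight `1`; window cut-off `M n := n`, `cc := 1`;
* FIRST LEGS `F′ i n w := (bfP i).f n 0 w · exp (−‖w‖∞²/n²)` — the table's own lattice legs, Gaussian-damped at the blocking scale
  (so that they sit inside the (W2′)₀ window `R/(‖w‖∞^{a−2} n²)` of the free leg AND have the (W3a)₀ exponential tails
  `R′ e^{−(r+1)/n}/(r+1)^a` beyond `‖w‖∞ ≥ n`); SECOND LEGS `G′ i n w := (bfQ i).f n 0 w` (window error `0`, power tails);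
* ONE-LOOP COEFFICIENTS `β⁰_j` := the successive INCREMENTS of the window sums `W m` of the leg bilinear at `n = Lc^m`, so that (D1)
  holds LITERALLY with `U = 0` (`sum_beta0 : Σ_{j<m} β⁰_j = W m`);
* the history-INDEPENDENT family `β_{k+1}(g_0,…,g_k) := β⁰_k` with the split `β¹ := 0` (`RemainderConst … 0`, `0 ≤ stepBal N Lc`);
  continuity is trivial; the upper bound `β⁰_k ≤ stepBal N Lc + 2A` is READ OFF the wall's own drift theorem
  (`ComposedRoad.oneLoopDrift_of_composedLegInterfacePow_identity_avg` at the trivial instance) — which also shows the witness is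
  non-degenerate: its coefficients DRIFT with the asymptotic-freedom slope `stepBal N Lc = (11N²/12π²)·log Lc` (`drift_witness`);
* the construction is the lead lineage's `FlowStepRuns.modelOf β` (`modelOf_forwardGenerated`).
`wall_inhabited` then APPLIES the END theorem BY NAME to these data (every binder instantiated by a proof term); `wallIII_inhabited`
does the same for the [III]-side twin `wallEND_trivial_avg_remainderConst_allProfiles` (34 explicit binders; `rr = 0 < stepBal`, `β₀ := 1`,
`L := 2`, `p := 0`, `κ₀ := 6`); `wall_binders_inhabited` lists the binder VALUES of the located items as one conjunction.
(v1.1, beta-ref A-R340 / lit3 C-lit3g17-1:) NOTE THAT (D1) AND (D4) ARE MET TAUTOLOGICALLY BY CONSTRUCTION — `β⁰` is DEFINED as the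
increments of the leg bilinear (so `hD1` holds with `U = 0`) and `β¹ := 0` (so `RemainderConst … 0`): the witness certifies CONSISTENCY of the
list and (D3)-shaped satisfiability of the leg rows by honest analytic data; it says nothing about the CONTENT of (D1)/(D4) for any
genuine one-loop family.

## What this is NOT

Not a model of Bałaban's objects: the damped free legs are NOT the one-shot fluctuation covariances of [Balaban1987RG1] §1, and the
increments `β⁰_j` are NOT (1.22).  The witness says exactly: the wall's hypothesis list is consistent and is met by leg data of the
very shape the (D3) rows describe (free table leg + `O(1/(‖w‖^{a−2}n²))` inside the window, `e^{−δ r/n}` tails outside) together with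
a drifting one-loop family — so the wall constrains Bałaban's objects only through the IDENTIFICATION content of (D1)/(D3)/(D4)/(D5),
as BETA/WALL.md §4 says.  Context only: [Balaban1987RG1] = T. Bałaban, Renormalization group approach to lattice gauge field
theories. I, Commun. Math. Phys. 109 (1987) 249–301, Theorem 2 p. 259.
-/

noncomputable section

namespace Literature.MathematicalPhysics.QuantumFieldTheory.Balaban1983to89.Beta.WallWitness

open Finset
open Literature.Probability.LatticeModels (annulus)
open Literature.MathematicalPhysics.QuantumFieldTheory.Balaban1983to89
open FlowStep FlowStepRuns DagBinding
open Literature.MathematicalPhysics.QuantumFieldTheory.Balaban1983to89.Beta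
open Literature.MathematicalPhysics.QuantumFieldTheory.Balaban1983to89.Beta.TransverseStructure (E4)
open Literature.MathematicalPhysics.QuantumFieldTheory.Balaban1983to89.Beta.LeadingCoefficient (leadingIntegrand kappaBal transverseValue)
open Literature.MathematicalPhysics.QuantumFieldTheory.Balaban1983to89.Beta.DyadicShell (Pt toReal supNorm mem_annulus_iff
  ne_zero_of_mem_annulus supNorm_pos supNorm_eq_of_mem_sphere)
open Literature.MathematicalPhysics.QuantumFieldTheory.Balaban1983to89.Beta.BubbleTransfer (Leg contBubble bubbleConst)
open Literature.MathematicalPhysics.QuantumFieldTheory.Balaban1983to89.Beta.RemainderChain (RemainderConst)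
open Literature.MathematicalPhysics.QuantumFieldTheory.Balaban1983to89.Beta.Drift (OneLoopDrift)
open Literature.MathematicalPhysics.QuantumFieldTheory.Balaban1983to89.Beta.MarginalTelescoping (composedCoeff IdentityForm)
open Literature.MathematicalPhysics.QuantumFieldTheory.Balaban1983to89.Beta.LargeLWindow.WindowDecomposition (constA)
open Literature.MathematicalPhysics.QuantumFieldTheory.Balaban1983to89.Beta.SquareTable (BfIdx bfCoeff bfP bfQ hdeg_bf hval_bf two_le_bfP_a)
open Literature.MathematicalPhysics.QuantumFieldTheory.Balaban1983to89.Beta.HidentScalewise (composedCoeff_trivial identityForm_trivial)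
open ComposedRoad

variable {μ ν : Fin 4}

/-! ## §1 Generic damped legs: one `Leg` inside the window and beyond it -/

/-- Gaussian damping at the blocking scale `n`: `exp (−‖w‖∞² / n²)`. [folklore] -/
def damp (n : ℕ) (w : Pt) : ℝ := Real.exp (-((supNorm w : ℝ) ^ 2 / (n : ℝ) ^ 2))

/-- The damping factor is positive. [folklore] -/
theorem damp_pos (n : ℕ) (w : Pt) : 0 < damp n w := Real.exp_pos _

/-- The damping factor is at most one. [folklore] -/
theorem damp_le_one (n : ℕ) (w : Pt) : damp n w ≤ 1 := by
  unfold damp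
  rw [Real.exp_le_one_iff, neg_nonpos]
  positivity

/-- `1 − e^{−x} ≤ x`: the damping defect is at most `‖w‖∞²/n²`. [folklore] -/
theorem one_sub_damp_le (n : ℕ) (w : Pt) : 1 - damp n w ≤ (supNorm w : ℝ) ^ 2 / (n : ℝ) ^ 2 := by
  unfold damp
  have h := Real.add_one_le_exp (-((supNorm w : ℝ) ^ 2 / (n : ℝ) ^ 2))
  linarith

/-- **WINDOW ROW for a damped leg.**  For a leg of degree `a ≥ 2` and `w ≠ 0`:
`|f(w)·e^{−‖w‖²/n²} − f(w)| ≤ (A+B)/(‖w‖^{a−2}·n²)` — the (W2′)₀ shape with `R := A + B`. [folklore] -/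
theorem damped_window (P : Leg) (ha : 2 ≤ P.a) {n : ℕ} (hn : 1 ≤ n) (L k : ℕ) {w : Pt} (hw : w ≠ 0) :
    |P.f L k w * damp n w - P.f L k w| ≤ (P.A + P.B) / ((supNorm w : ℝ) ^ (P.a - 2) * (n : ℝ) ^ 2) := by
  have hs : (1 : ℝ) ≤ supNorm w := Leg.one_le_supNorm hw
  have hs0 : (0 : ℝ) < supNorm w := by linarith
  have hn0 : (0 : ℝ) < n := by exact_mod_cast hn
  have hf := P.abs_f_le L k hw
  have hd : (0 : ℝ) ≤ 1 - damp n w := sub_nonneg.mpr (damp_le_one n w)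
  have hAB : 0 ≤ (P.A + P.B) / (supNorm w : ℝ) ^ P.a := div_nonneg (add_nonneg P.nonneg_A P.nonneg_B) (pow_nonneg hs0.le _)
  have h1 : |P.f L k w * damp n w - P.f L k w| = |P.f L k w| * (1 - damp n w) := by
    rw [show P.f L k w * damp n w - P.f L k w = -(P.f L k w * (1 - damp n w)) by ring, abs_neg, abs_mul, abs_of_nonneg hd]
  rw [h1]
  calc |P.f L k w| * (1 - damp n w)
      ≤ (P.A + P.B) / (supNorm w : ℝ) ^ P.a * ((supNorm w : ℝ) ^ 2 / (n : ℝ) ^ 2) :=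
        mul_le_mul hf (one_sub_damp_le n w) hd hAB
    _ = (P.A + P.B) / ((supNorm w : ℝ) ^ (P.a - 2) * (n : ℝ) ^ 2) := by
        have hsplit : (supNorm w : ℝ) ^ P.a = (supNorm w : ℝ) ^ (P.a - 2) * (supNorm w : ℝ) ^ 2 := by
          rw [← pow_add, Nat.sub_add_cancel ha]
        rw [hsplit]
        field_simp

/-- **EXPONENTIAL TAIL ROW for a damped leg.**  Beyond the window (`n ≤ r`), on the shell `‖w‖∞ = r + 1`:
`|f(w)·e^{−‖w‖²/n²}| ≤ (A+B)/(r+1)^a · e^{−(1/n)(r+1)}` — the (W3a)₀ shape with `R′ := A + B`, `δ := 1`. [folklore] -/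
theorem damped_tail (P : Leg) {n : ℕ} (hn : 1 ≤ n) (L k : ℕ) {r : ℕ} (hr : n ≤ r) {w : Pt} (hw : w ∈ annulus 4 r (r + 1)) :
    |P.f L k w * damp n w| ≤ (P.A + P.B) / ((r : ℝ) + 1) ^ P.a * Real.exp (-(1 / (n : ℝ)) * ((r : ℝ) + 1)) := by
  have hw0 : w ≠ 0 := ne_zero_of_mem_annulus hw
  have hsn : (supNorm w : ℝ) = (r : ℝ) + 1 := by exact_mod_cast supNorm_eq_of_mem_sphere hw
  have hn0 : (0 : ℝ) < n := by exact_mod_cast hn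
  have hf := P.abs_f_le L k hw0
  rw [hsn] at hf
  rw [abs_mul, abs_of_pos (damp_pos n w)]
  refine mul_le_mul hf ?_ (damp_pos n w).le (by have := P.nonneg_A; have := P.nonneg_B; positivity)
  -- `e^{−(r+1)²/n²} ≤ e^{−(r+1)/n}` since `(r+1)/n ≥ 1`
  unfold damp
  rw [hsn, Real.exp_le_exp]
  have hq : (1 : ℝ) ≤ ((r : ℝ) + 1) / (n : ℝ) := by
    rw [le_div_iff₀ hn0]
    have : (n : ℝ) ≤ r := by exact_mod_cast hr
    linarith
  have hsq : ((r : ℝ) + 1) / (n : ℝ) ≤ (((r : ℝ) + 1) / (n : ℝ)) ^ 2 := by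
    nlinarith
  have hrew : ((r : ℝ) + 1) ^ 2 / (n : ℝ) ^ 2 = (((r : ℝ) + 1) / (n : ℝ)) ^ 2 := by rw [div_pow]
  rw [hrew, show -(1 / (n : ℝ)) * ((r : ℝ) + 1) = -(((r : ℝ) + 1) / (n : ℝ)) by ring]
  linarith

/-- **POWER TAIL ROW for an undamped leg** on the shell `‖w‖∞ = r + 1`: `|f(w)| ≤ (A+B)/(r+1)^a`. [folklore] -/
theorem plain_tail (P : Leg) (L k : ℕ) {r : ℕ} {w : Pt} (hw : w ∈ annulus 4 r (r + 1)) :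
    |P.f L k w| ≤ (P.A + P.B) / ((r : ℝ) + 1) ^ P.a := by
  have hw0 : w ≠ 0 := ne_zero_of_mem_annulus hw
  have hsn : (supNorm w : ℝ) = (r : ℝ) + 1 := by exact_mod_cast supNorm_eq_of_mem_sphere hw
  simpa [hsn] using P.abs_f_le L k hw0

/-! ## §2 The witness data over the realised table -/

/-- One base point. [folklore] -/
def Bset : ℕ → Finset Unit := fun _ => univ

/-- Weight one. [folklore] -/
def wt : ℕ → Unit → ℝ := fun _ _ => 1

/-- Window cut-off `M n := n`. [folklore] -/
def Mw : ℕ → ℕ := fun n => n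

/-- FIRST LEGS of the witness: the table's first legs, Gaussian-damped at the blocking scale. [folklore] -/
def Fw (hμν : μ ≠ ν) : Unit → BfIdx → ℕ → Pt → ℝ := fun _ i n w => (bfP hμν i).f n 0 w * damp n w

/-- SECOND LEGS of the witness: the table's second legs themselves. [folklore] -/
def Gw (hμν : μ ≠ ν) : Unit → BfIdx → ℕ → Pt → ℝ := fun _ i n w => (bfQ hμν i).f n 0 w

/-- Window constants `R i = R′ i := A_i + B_i` of the first legs. [folklore] -/
def RP (hμν : μ ≠ ν) : BfIdx → ℝ := fun i => (bfP hμν i).A + (bfP hμν i).B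

/-- Tail constants `S′ i := A_i + B_i` of the second legs. [folklore] -/
def SQ (hμν : μ ≠ ν) : BfIdx → ℝ := fun i => (bfQ hμν i).A + (bfQ hμν i).B

/-- The WINDOW SUM of the leg bilinear at blocking `n = Lc^m`, radius `R₀ := M (Lc^m)`. [folklore] -/
def W (hμν : μ ≠ ν) (N : ℝ) (Lc m : ℕ) : ℝ :=
  ∑ b ∈ Bset (Lc ^ m), wt (Lc ^ m) b * ∑ w ∈ annulus 4 0 (Mw (Lc ^ m)), toReal w μ * toReal w ν *
    ∑ i ∈ (univ : Finset BfIdx), bfCoeff N i * (Fw hμν b i (Lc ^ m) w * Gw hμν b i (Lc ^ m) w)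

/-- ONE-LOOP COEFFICIENTS of the witness: the increments of the window sums (`β⁰_0 := W 1`, `β⁰_{j+1} := W (j+2) − W (j+1)`).
[folklore] -/
def beta0 (hμν : μ ≠ ν) (N : ℝ) (Lc : ℕ) : ℕ → ℝ
  | 0 => W hμν N Lc 1
  | j + 1 => W hμν N Lc (j + 2) - W hμν N Lc (j + 1)

/-- (D1) LITERALLY, error `0`: `Σ_{j<m} β⁰_j = W m` for `m ≥ 1`. [folklore] -/
theorem sum_beta0 (hμν : μ ≠ ν) (N : ℝ) (Lc : ℕ) : ∀ m : ℕ, 1 ≤ m → ∑ j ∈ range m, beta0 hμν N Lc j = W hμν N Lc m := by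
  intro m hm
  induction m with
  | zero => exact absurd hm (by norm_num)
  | succ m ih =>
      rcases Nat.eq_zero_or_pos m with h0 | h0
      · subst h0; simp [beta0]
      · rw [sum_range_succ, ih h0]
        obtain ⟨j, rfl⟩ : ∃ j, m = j + 1 := ⟨m - 1, by omega⟩
        simp only [beta0]
        ring

/-- The history-INDEPENDENT β-family of the witness: `β_{k+1}(g_0,…,g_k) := β⁰_k`. [folklore] -/
def betaW (hμν : μ ≠ ν) (N : ℝ) (Lc : ℕ) : HBeta := fun k _ => beta0 hμν N Lc k

/-- Its one-loop split: `β¹ := 0` (vanishing at `g_k = 0` holds trivially). [folklore] -/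
def splitW (hμν : μ ≠ ν) (N : ℝ) (Lc : ℕ) : B12Beta.OneLoopSplit (betaW hμν N Lc) where
  β0 := beta0 hμν N Lc
  β1 := fun _ _ => 0
  split := fun k p => by simp [betaW]
  vanish := fun _ _ _ => rfl

/-! ## §3 Every binder of the END theorem, at the witness (statements = the wall's binder shapes verbatim) -/

/-- Weights are nonnegative. [folklore] -/
theorem hwt0_w : ∀ n : ℕ, 2 ≤ n → ∀ b ∈ Bset n, 0 ≤ wt n b := fun _ _ _ _ => zero_le_one

/-- Weights sum to one. [folklore] -/
theorem hwt1_w : ∀ n : ℕ, 2 ≤ n → ∑ b ∈ Bset n, wt n b = 1 := fun n _ => by simp [Bset, wt]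

/-- Window cut-off admissible with `cc := 1`. [folklore] -/
theorem hM_w : ∀ L : ℕ, 2 ≤ L → 1 ≤ Mw L ∧ (L : ℝ) ≤ 1 * Mw L := fun L hL => ⟨by unfold Mw; omega, by simp [Mw]⟩

/-- Window cut-off at most the blocking factor. [folklore] -/
theorem hML_w : ∀ L : ℕ, 2 ≤ L → Mw L ≤ L := fun _ _ => le_rfl

/-- First-leg constants are nonnegative. [folklore] -/
theorem hRP_w (hμν : μ ≠ ν) : ∀ i ∈ (univ : Finset BfIdx), 0 ≤ RP hμν i :=
  fun i _ => add_nonneg (bfP hμν i).nonneg_A (bfP hμν i).nonneg_B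

/-- Second-leg constants are nonnegative. [folklore] -/
theorem hSQ_w (hμν : μ ≠ ν) : ∀ i ∈ (univ : Finset BfIdx), 0 ≤ SQ hμν i :=
  fun i _ => add_nonneg (bfQ hμν i).nonneg_A (bfQ hμν i).nonneg_B

/-- The zero constants are nonnegative. [folklore] -/
theorem hzero_w : ∀ i ∈ (univ : Finset BfIdx), (0 : ℝ) ≤ (fun _ => (0 : ℝ)) i := fun _ _ => le_rfl

/-- Blocking factors `Lc^m ≥ 1`. [folklore] -/
theorem one_le_pow_of_two_le {Lc : ℕ} (hL : 2 ≤ Lc) (m : ℕ) : 1 ≤ Lc ^ m := Nat.one_le_pow _ _ (by omega)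

/-- (W2′)₀ first legs: inside the window the damped leg is within `R_i/(‖w‖^{a−2}n²)` of the table leg. [folklore] -/
theorem hF_w (hμν : μ ≠ ν) {Lc : ℕ} (hL : 2 ≤ Lc) :
    ∀ m : ℕ, 1 ≤ m → ∀ b ∈ Bset (Lc ^ m), ∀ w ∈ annulus 4 0 (Mw (Lc ^ m)), ∀ i ∈ (univ : Finset BfIdx),
      |Fw hμν b i (Lc ^ m) w - (bfP hμν i).f (Lc ^ m) 0 w| ≤
        RP hμν i / ((supNorm w : ℝ) ^ ((bfP hμν i).a - 2) * ((Lc ^ m : ℕ) : ℝ) ^ 2) := by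
  intro m _ b _ w hw i _
  exact damped_window (bfP hμν i) (two_le_bfP_a hμν i) (one_le_pow_of_two_le hL m) _ _ (ne_zero_of_mem_annulus hw)

/-- (W2′)₀ second legs: window error `0`. [folklore] -/
theorem hG_w (hμν : μ ≠ ν) {Lc : ℕ} :
    ∀ m : ℕ, 1 ≤ m → ∀ b ∈ Bset (Lc ^ m), ∀ w ∈ annulus 4 0 (Mw (Lc ^ m)), ∀ i ∈ (univ : Finset BfIdx),
      |Gw hμν b i (Lc ^ m) w - (bfQ hμν i).f (Lc ^ m) 0 w| ≤
        (fun _ => (0 : ℝ)) i / ((supNorm w : ℝ) ^ ((bfQ hμν i).a - 2) * ((Lc ^ m : ℕ) : ℝ) ^ 2) := by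
  intro m _ b _ w _ i _
  simp [Gw]

/-- (W3a)₀ first legs: exponential tails beyond the window, rate `δ := 1` per blocking scale. [folklore] -/
theorem hFtail_w (hμν : μ ≠ ν) {Lc : ℕ} (hL : 2 ≤ Lc) :
    ∀ m : ℕ, 1 ≤ m → ∀ b ∈ Bset (Lc ^ m), ∀ r : ℕ, Mw (Lc ^ m) ≤ r → ∀ w ∈ annulus 4 r (r + 1), ∀ i ∈ (univ : Finset BfIdx),
      |Fw hμν b i (Lc ^ m) w| ≤
        RP hμν i / ((r : ℝ) + 1) ^ (bfP hμν i).a * Real.exp (-((1 : ℝ) / ((Lc ^ m : ℕ) : ℝ)) * ((r : ℝ) + 1)) := by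
  intro m _ b _ r hr w hw i _
  exact damped_tail (bfP hμν i) (one_le_pow_of_two_le hL m) _ _ hr hw

/-- (W3a)₀ second legs: power tails. [folklore] -/
theorem hGtail_w (hμν : μ ≠ ν) {Lc : ℕ} :
    ∀ m : ℕ, 1 ≤ m → ∀ b ∈ Bset (Lc ^ m), ∀ r : ℕ, Mw (Lc ^ m) ≤ r → ∀ w ∈ annulus 4 r (r + 1), ∀ i ∈ (univ : Finset BfIdx),
      |Gw hμν b i (Lc ^ m) w| ≤ SQ hμν i / ((r : ℝ) + 1) ^ (bfQ hμν i).a := by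
  intro m _ b _ r _ w hw i _
  exact plain_tail (bfQ hμν i) _ _ hw

/-- (D1) LITERALLY at the witness, error `U := 0`, radius `R₀ := M (Lc^m)`. [folklore] -/
theorem hD1_w (hμν : μ ≠ ν) (N : ℝ) (Lc : ℕ) :
    ∀ m : ℕ, 1 ≤ m → ∃ R₀ : ℕ, Mw (Lc ^ m) ≤ R₀ ∧
      |∑ j ∈ range m, (splitW hμν N Lc).β0 j - ∑ b ∈ Bset (Lc ^ m), wt (Lc ^ m) b * ∑ w ∈ annulus 4 0 R₀,
        toReal w μ * toReal w ν * ∑ i ∈ (univ : Finset BfIdx), bfCoeff N i * (Fw hμν b i (Lc ^ m) w * Gw hμν b i (Lc ^ m) w)|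
        ≤ 0 := by
  intro m hm
  refine ⟨Mw (Lc ^ m), le_rfl, ?_⟩
  have h : ∑ j ∈ range m, (splitW hμν N Lc).β0 j = W hμν N Lc m := sum_beta0 hμν N Lc m hm
  rw [h, W, sub_self, abs_zero]

/-- (D4) at the witness: `β¹ = 0`, so `RemainderConst … γ₀ 0` for every `γ₀`. [folklore] -/
theorem hrem_w (hμν : μ ≠ ν) (N : ℝ) (Lc : ℕ) (γ₀ : ℝ) : RemainderConst (splitW hμν N Lc) γ₀ 0 :=
  fun _ _ _ => by simp [splitW]

/-- `0 ≤ stepBal N Lc` for `Lc ≥ 1` (the slope `(11N²/12π²)·log Lc`). [folklore] -/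
theorem stepBal_nonneg (N : ℝ) {Lc : ℕ} (hL : 1 ≤ Lc) : 0 ≤ B12Normalization.stepBal N Lc := by
  rw [B12Normalization.stepBal_eq]
  have hlog : 0 ≤ Real.log (Lc : ℝ) := Real.log_nonneg (by exact_mod_cast hL)
  positivity

/-- (D5) continuity at the witness: each `β_{k+1}` is constant in the history. [folklore] -/
theorem hcont_w (hμν : μ ≠ ν) (N : ℝ) (Lc : ℕ) (γ₀ : ℝ) : BetaContH γ₀ (betaW hμν N Lc) :=
  fun _ => continuousOn_const

/-- A drift bound gives a uniform UPPER bound on the coefficients: `β⁰_k ≤ b + 2A`. [folklore] -/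
theorem le_of_oneLoopDrift {b A : ℝ} {β0 : ℕ → ℝ} (h : OneLoopDrift b A β0) (k : ℕ) : β0 k ≤ b + 2 * A := by
  have h1 := (abs_le.mp (h (k + 1))).2
  have h2 := (abs_le.mp (h k)).1
  rw [sum_range_succ] at h1
  push_cast at h1
  linarith

/-! ## §4 The drift of the witness (non-degeneracy) and the END theorem applied -/

/-- **THE WITNESS DRIFTS WITH THE ASYMPTOTIC-FREEDOM SLOPE**: `|Σ_{j<k} β⁰_j − stepBal N Lc · k| ≤ A` for an explicit window constant
`A` — the lead's §10 drift theorem at the trivial instance, every binder instantiated.  In particular the witness family is not the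
zero family. [folklore] -/
theorem drift_witness (hμν : μ ≠ ν) {N : ℝ} (hN : N ≠ 0) {Lc : ℕ} (hL : 2 ≤ Lc) :
    ∃ A : ℝ, OneLoopDrift (B12Normalization.stepBal N Lc) A (beta0 hμν N Lc) :=
  ⟨_, oneLoopDrift_of_composedLegInterfacePow_identity_avg (μC := fun j _ => (splitW hμν N Lc).β0 j) (splitW hμν N Lc)
    (hdeg_bf hμν) hμν hN (hval_bf hμν N) hL hwt0_w hwt1_w (hRP_w hμν) hzero_w (hRP_w hμν) (hSQ_w hμν) one_pos le_rfl hM_w hML_w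
    (hF_w hμν hL) (hG_w hμν) (hFtail_w hμν hL) (hGtail_w hμν)
    (fun m hm => by simpa only [composedCoeff_trivial] using hD1_w hμν N Lc m hm) (identityForm_trivial _)⟩

/-- (D5) upper bound at the witness, read off the drift. [folklore] -/
theorem hup_w (hμν : μ ≠ ν) {N : ℝ} (hN : N ≠ 0) {Lc : ℕ} (hL : 2 ≤ Lc) (γ₀ : ℝ) :
    ∃ β' : ℝ, 0 ≤ β' ∧ BetaUpperH β' γ₀ (betaW hμν N Lc) := by
  obtain ⟨A, hA⟩ := drift_witness hμν hN hL
  refine ⟨B12Normalization.stepBal N Lc + 2 * A, ?_, fun k v _ => le_of_oneLoopDrift hA k⟩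
  have := hA.nonneg
  have := stepBal_nonneg N (show 1 ≤ Lc by omega)
  positivity

/-- **JOINT NON-VACUITY OF THE STATEMENT-GRADE WALL.**  For every `N ≠ 0`, `Lc ≥ 2`, `μ ≠ ν` the END theorem
`AveragedAFCarrierScalewise.endpointExistence_trivial_avg_remainderConst` APPLIES to the witness: all twenty-eight explicit binders are
instantiated by the proof terms of §3 (table = an3's realised table; legs = damped / plain table legs; (D1) with `U = 0`; (D4) with
`rr = 0`; (D5) from the drift; `γ₀ = 1`; construction `modelOf`).  Discharges NOTHING for Bałaban's objects. [folklore] -/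
theorem wall_inhabited (hμν : μ ≠ ν) {N : ℝ} (hN : N ≠ 0) {Lc : ℕ} (hL : 2 ≤ Lc) :
    EndpointExistence (modelOf (betaW hμν N Lc)) := by
  obtain ⟨β', hβ', hup⟩ := hup_w hμν hN hL 1
  exact AveragedAFCarrierScalewise.endpointExistence_trivial_avg_remainderConst (modelOf_forwardGenerated _) (splitW hμν N Lc)
    (hdeg_bf hμν) hμν hN (hval_bf hμν N) hL hwt0_w hwt1_w (hRP_w hμν) hzero_w (hRP_w hμν) (hSQ_w hμν) one_pos le_rfl hM_w hML_w
    (hF_w hμν hL) (hG_w hμν) (hFtail_w hμν hL) (hGtail_w hμν) (hD1_w hμν N Lc) one_pos (hrem_w hμν N Lc 1)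
    (stepBal_nonneg N (show 1 ≤ Lc by omega)) hβ' (hcont_w hμν N Lc 1) hup

/-- **JOINT NON-VACUITY, [III] SIDE.**  The co-lead's twin `AveragedAFCarrierScalewise.wallEND_trivial_avg_remainderConst_allProfiles`
(thirty-four explicit binders: the above with `rr < stepBal` STRICT, plus `HaltsOutside`, `CurriesHBeta`, `0 < β₀`, `L ≥ 2`, the
maximal exponent `p` and `κ₀ ≥ 6`) APPLIES to the same witness (`β₀ := 1`, `L := 2`, `p := 0`, `κ₀ := 6`): `EndpointExistence` AND the
[III] list along every run of `modelOf β` in `]0, γ]`, `γ ≤ min 1 γ₁`.  Discharges NOTHING for Bałaban's objects. [folklore] -/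
theorem wallIII_inhabited (hμν : μ ≠ ν) {N : ℝ} (hN : N ≠ 0) {Lc : ℕ} (hL : 2 ≤ Lc) :
    ∃ β' : ℝ, 0 ≤ β' ∧ (EndpointExistence (modelOf (betaW hμν N Lc)) ∧ ∃ γ₁ : ℝ, 0 < γ₁ ∧
      ∀ γ : ℝ, 0 < γ → γ ≤ min 1 γ₁ → ∀ Pr : B12.RunParams, (modelOf (betaW hμν N Lc) Pr).flow.InInterval γ Pr.K →
        ∀ p' : ℕ, p' ≤ 0 → ∀ A₀ : ℝ, 0 ≤ A₀ →
          ∃ Rj : ℕ → ℕ, (∀ j, B14.IsRj 2 p' ((modelOf (betaW hμν N Lc) Pr).flow.g j) (Rj j)) ∧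
            B14DeltaBeta.HorizonFacts (modelOf (betaW hμν N Lc) Pr).flow β' 1 A₀ 2 p' 6 Rj Pr.K) := by
  obtain ⟨β', hβ', hup⟩ := hup_w hμν hN hL 1
  have hpos : (0 : ℝ) < B12Normalization.stepBal N Lc := by
    rw [B12Normalization.stepBal_eq]
    have hlog : 0 < Real.log (Lc : ℝ) := Real.log_pos (by exact_mod_cast hL)
    have h1 : 0 < 11 * N ^ 2 / (12 * Real.pi ^ 2) := by positivity
    exact mul_pos h1 hlog
  exact ⟨β', hβ', AveragedAFCarrierScalewise.wallEND_trivial_avg_remainderConst_allProfiles (modelOf_forwardGenerated _)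
    (modelOf_haltsOutside _) (modelOf_curries _) (splitW hμν N Lc)
    (hdeg_bf hμν) hμν hN (hval_bf hμν N) hL hwt0_w hwt1_w (hRP_w hμν) hzero_w (hRP_w hμν) (hSQ_w hμν) one_pos le_rfl hM_w hML_w
    (hF_w hμν hL) (hG_w hμν) (hFtail_w hμν hL) (hGtail_w hμν) (hD1_w hμν N Lc) one_pos (hrem_w hμν N Lc 1) hpos
    (hcont_w hμν N Lc 1) hup hβ' one_pos le_rfl 0 le_rfl⟩

/-- The same instantiation recorded as ONE conjunction of the β-binders that are located items of the wall ((D1), (D4), (D5)) plus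
the structural clauses, at `γ₀ = 1` — for readers who want the binder VALUES rather than the applied theorem. [folklore] -/
theorem wall_binders_inhabited (hμν : μ ≠ ν) {N : ℝ} (hN : N ≠ 0) {Lc : ℕ} (hL : 2 ≤ Lc) :
    ForwardGenerated (modelOf (betaW hμν N Lc)) (betaW hμν N Lc) ∧ HaltsOutside (modelOf (betaW hμν N Lc)) (betaW hμν N Lc) ∧
    CurriesHBeta (modelOf (betaW hμν N Lc)) (betaW hμν N Lc) ∧
    (∀ m : ℕ, 1 ≤ m → ∃ R₀ : ℕ, Mw (Lc ^ m) ≤ R₀ ∧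
      |∑ j ∈ range m, (splitW hμν N Lc).β0 j - ∑ b ∈ Bset (Lc ^ m), wt (Lc ^ m) b * ∑ w ∈ annulus 4 0 R₀,
        toReal w μ * toReal w ν * ∑ i ∈ (univ : Finset BfIdx), bfCoeff N i * (Fw hμν b i (Lc ^ m) w * Gw hμν b i (Lc ^ m) w)|
        ≤ 0) ∧
    RemainderConst (splitW hμν N Lc) 1 0 ∧ (0 : ℝ) < B12Normalization.stepBal N Lc ∧
    BetaContH 1 (betaW hμν N Lc) ∧ (∃ β' : ℝ, 0 ≤ β' ∧ BetaUpperH β' 1 (betaW hμν N Lc)) ∧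
    (∃ A : ℝ, OneLoopDrift (B12Normalization.stepBal N Lc) A (beta0 hμν N Lc)) := by
  refine ⟨modelOf_forwardGenerated _, modelOf_haltsOutside _, modelOf_curries _, hD1_w hμν N Lc, hrem_w hμν N Lc 1, ?_,
    hcont_w hμν N Lc 1, hup_w hμν hN hL 1, drift_witness hμν hN hL⟩
  rw [B12Normalization.stepBal_eq]
  have hlog : 0 < Real.log (Lc : ℝ) := Real.log_pos (by exact_mod_cast hL)
  have h1 : 0 < 11 * N ^ 2 / (12 * Real.pi ^ 2) := by positivity
  exact mul_pos h1 hlog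

end Literature.MathematicalPhysics.QuantumFieldTheory.Balaban1983to89.Beta.WallWitness
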